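import Summits.HubbardSuperconductivity.HubbardSuperconductivity.Theorems.NodalWardXYVisonPairCostIRDefs
import Summits.HubbardSuperconductivity.HubbardSuperconductivity.Theorems.NodalWardXYVisonPairCostUltraviolet

/-!
# Mirror set-up: crux `VisonPairCost` (stmt-HubbardSuperconductivity-1266), line `Sketch`, stub `stub_mirrorSetup`

`MirrorSetup` (statement (IR-2) of `NodalWardXYVisonPairCostIRDefs`): for `L ≥ 4` (and any `R`) the string
orbitals `A = strA L R` and the mirror complement `B = mirB L R` are disjoint (`strA_disjoint_mirB`, IRDefs),
the coboundary perturbation `V = U N₀ U − N₀` of the half-torus gauge `U = mirU L` (`−1` on the rows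
`1 … ⌊L/2⌋`) splits as `V = P_A V P_A + P_B V P_B`, and the vison string is its `A`-part:
`N_R = N₀ + P_A V P_A` (`N_R = visonNambu L μ Δ₀ R`).

Proof (entrywise, orbitals `(x,σ)`, `(y,σ')` over sites `x, y` of the fermionic torus).
* `V((x,σ),(y,σ')) = 0` if the half-torus signs of `x` and `y` agree, and `= −2 N₀((x,σ),(y,σ'))` otherwise
  (`ms_mirV_orb_orb`).
* `N₀((x,σ),(y,σ')) ≠ 0` forces `x = y` or `x ∼ y` (`visonNambu_apply_eq_zero`, Ultraviolet file); along a
  unit step the half-torus sign changes exactly across the bond-rows `0|1` and `⌊L/2⌋|⌊L/2⌋+1`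
  (`ms_step_sign_change`; `L ≥ 4` keeps the residues `0, 1, ⌊L/2⌋, ⌊L/2⌋+1, L−1` honest), and such a vertical
  bond lies inside `A × A` (column `< R`, rows `0,1`) or inside `B × B` (`ms_bond_mem`) — whence the splitting.
* Gauge covariance of the bond data (`visonHop_gauge`, `visonPair_gauge`, `bdgNambuMatrix_gauge_orb_orb`):
  `N_R = −N₀` on the string bonds `(a,0)–(a,1)`, `a < R` (`ms_visonNambu_flip`, local gauge `−1` at one end)
  and `N_R = N₀` on every other pair (`ms_visonNambu_eq`, trivial gauge); on a string bond both ends are in `A`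
  with opposite half-torus signs, so `P_A V P_A = −2N₀ = N_R − N₀` there, and `P_A V P_A = 0 = N_R − N₀`
  elsewhere.
No definition is introduced.
-/

noncomputable section

-- tree namespace Summit.HubbardSuperconductivity.HubbardSuperconductivity (D-0017)
set_option linter.dupNamespace false

namespace Summit.HubbardSuperconductivity.HubbardSuperconductivity.Theorems.VisonPairCost

open Literature.Probability.LatticeModels Literature.MathematicalPhysics.QuantumLattice
open scoped Matrix

section Torus

variable {L : ℕ}

/-! ### Unit steps on the discrete torus `(ℤ/Lℤ)²`, `L ≥ 4` -/

/-- Successor on `ZMod L` in canonical representatives. -/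
theorem ms_val_eq_of_eq_add_one (hL : 4 ≤ L) {a b : ZMod L} (h : b = a + 1) :
    (b.val = a.val + 1 ∧ a.val + 1 < L) ∨ (b.val = 0 ∧ a.val + 1 = L) := by
  haveI : NeZero L := ⟨by omega⟩
  haveI : Fact (1 < L) := ⟨by omega⟩
  have ha := ZMod.val_lt a
  rw [h, ZMod.val_add, ZMod.val_one]
  rcases Nat.lt_or_ge (a.val + 1) L with h' | h'
  · exact Or.inl ⟨Nat.mod_eq_of_lt h', h'⟩
  · have heq : a.val + 1 = L := by omega
    exact Or.inr ⟨by rw [heq, Nat.mod_self], heq⟩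

/-- A unit step on the torus is not the identity. -/
theorem ms_add_single_ne (hL : 4 ≤ L) (z : TorusSite 2 L) (i : Fin 2) : z + Pi.single i 1 ≠ z := by
  intro h
  have hi := congrFun h i
  rw [Pi.add_apply, Pi.single_eq_same] at hi
  rcases ms_val_eq_of_eq_add_one hL hi.symm with ⟨h1, -⟩ | ⟨h1, h2⟩ <;> omega

/-- Two unit steps never return to the starting site (`L ≥ 3`). -/
theorem ms_add_single_add_single_ne (hL : 4 ≤ L) (z : TorusSite 2 L) (i j : Fin 2) :
    z + Pi.single i 1 + Pi.single j 1 ≠ z := by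
  intro h
  have hj := congrFun h j
  simp only [Pi.add_apply, Pi.single_eq_same] at hj
  rcases eq_or_ne j i with rfl | hji
  · rw [Pi.single_eq_same] at hj
    rcases ms_val_eq_of_eq_add_one hL (rfl : z j + 1 = z j + 1) with ⟨h1, h1'⟩ | ⟨h1, h1'⟩ <;>
      rcases ms_val_eq_of_eq_add_one hL hj.symm with ⟨h2, h2'⟩ | ⟨h2, h2'⟩ <;> omega
  · rw [Pi.single_eq_of_ne hji, add_zero] at hj
    rcases ms_val_eq_of_eq_add_one hL hj.symm with ⟨h1, -⟩ | ⟨h1, h2⟩ <;> omega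

/-- Distinct directions give distinct unit steps. -/
theorem ms_single_step_unique (hL : 4 ≤ L) {z : TorusSite 2 L} {i j : Fin 2}
    (h : z + Pi.single i 1 = z + Pi.single j 1) : i = j := by
  by_contra hij
  have hi := congrFun h i
  rw [Pi.add_apply, Pi.add_apply, Pi.single_eq_same, Pi.single_eq_of_ne hij, add_zero] at hi
  rcases ms_val_eq_of_eq_add_one hL hi.symm with ⟨h1, -⟩ | ⟨h1, h2⟩ <;> omega

/-- Along a unit step the half-torus sign (`−1` on the rows `1 … ⌊L/2⌋`) changes exactly on the vertical bonds
of the bond-rows `0|1` and `⌊L/2⌋|⌊L/2⌋+1`. -/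
theorem ms_step_sign_change (hL : 4 ≤ L) {x y : TorusSite 2 L} {i : Fin 2}
    (hstep : y = x + Pi.single i 1)
    (hne : ¬((1 ≤ (x 1).val ∧ (x 1).val ≤ L / 2) ↔ (1 ≤ (y 1).val ∧ (y 1).val ≤ L / 2))) :
    i = 1 ∧ (x 1 = 0 ∨ x 1 = ((L / 2 : ℕ) : ZMod L)) := by
  haveI : NeZero L := ⟨by omega⟩
  have h1 := congrFun hstep 1
  rw [Pi.add_apply] at h1
  obtain rfl | rfl : i = 0 ∨ i = 1 := by fin_cases i <;> simp
  · rw [Pi.single_eq_of_ne (by decide : (1 : Fin 2) ≠ 0), add_zero] at h1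
    exact absurd (by rw [h1]) hne
  · rw [Pi.single_eq_same] at h1
    refine ⟨rfl, ?_⟩
    have hxl := ZMod.val_lt (x 1)
    have key : (x 1).val = 0 ∨ (x 1).val = L / 2 := by
      rcases ms_val_eq_of_eq_add_one hL h1 with ⟨h2, h3⟩ | ⟨h2, h3⟩
      · by_contra hcon
        push Not at hcon
        apply hne
        rw [h2]
        constructor
        · rintro ⟨ha, hb⟩; exact ⟨by omega, by omega⟩
        · rintro ⟨ha, hb⟩; exact ⟨by omega, by omega⟩
      · exfalso
        apply hne
        rw [h2]
        constructor
        · rintro ⟨ha, hb⟩; omega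
        · rintro ⟨ha, hb⟩; omega
    rcases key with h | h
    · left
      rw [← ZMod.natCast_zmod_val (x 1), h, Nat.cast_zero]
    · right
      rw [← ZMod.natCast_zmod_val (x 1), h]

/-- `⌊L/2⌋` is neither `0` nor `1` modulo `L ≥ 4`. -/
theorem ms_half_ne (hL : 4 ≤ L) : ((L / 2 : ℕ) : ZMod L) ≠ 0 ∧ ((L / 2 : ℕ) : ZMod L) ≠ 1 := by
  haveI : NeZero L := ⟨by omega⟩
  haveI : Fact (1 < L) := ⟨by omega⟩
  have hv : ((L / 2 : ℕ) : ZMod L).val = L / 2 := ZMod.val_natCast_of_lt (by omega)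
  constructor <;> intro h <;> have h' := congrArg ZMod.val h <;>
    simp only [hv, ZMod.val_zero, ZMod.val_one] at h' <;> omega

/-- The two ends of an upward vertical bond leaving row `0`: same column, rows `0` and `1`. -/
theorem ms_string_bond (hL : 4 ≤ L) {x y : FermionTorus 2 L}
    (hxy : y.toTorusSite = x.toTorusSite + Pi.single 1 1) (hx1 : x.toTorusSite 1 = 0) :
    y.toTorusSite 0 = x.toTorusSite 0 ∧ y.toTorusSite 1 = 1 ∧
      (x.toTorusSite 1).val = 0 ∧ (y.toTorusSite 1).val = 1 := by
  haveI : Fact (1 < L) := ⟨by omega⟩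
  have h0 := congrFun hxy 0
  have h1 := congrFun hxy 1
  rw [Pi.add_apply, Pi.single_eq_of_ne (by decide : (0 : Fin 2) ≠ 1), add_zero] at h0
  rw [Pi.add_apply, Pi.single_eq_same, hx1, zero_add] at h1
  exact ⟨h0, h1, by rw [hx1, ZMod.val_zero], by rw [h1, ZMod.val_one]⟩

/-! ### Orbital bookkeeping: memberships, the half-torus sign, the projections -/

/-- Membership of an orbital in the string set `A`. -/
theorem ms_orb_mem_strA {R : ℕ} {x : FermionTorus 2 L} {σ : Fin 2} :
    orb x σ ∈ strA L R ↔ (x.toTorusSite 0).val < R ∧ (x.toTorusSite 1 = 0 ∨ x.toTorusSite 1 = 1) := by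
  simp only [strA, Finset.mem_filter, Finset.mem_univ, true_and, colOf, rowOf, orb, ofLex_toLex]

/-- Membership of an orbital in the mirror complement `B`. -/
theorem ms_orb_mem_mirB {R : ℕ} {x : FermionTorus 2 L} {σ : Fin 2} :
    orb x σ ∈ mirB L R ↔ (R ≤ (x.toTorusSite 0).val ∧ (x.toTorusSite 1 = 0 ∨ x.toTorusSite 1 = 1)) ∨
      (x.toTorusSite 1 = ((L / 2 : ℕ) : ZMod L) ∨ x.toTorusSite 1 = ((L / 2 + 1 : ℕ) : ZMod L)) := by
  simp only [mirB, Finset.mem_filter, Finset.mem_univ, true_and, colOf, rowOf, orb, ofLex_toLex]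

/-- Entries of `U M U` for the half-torus sign `U = mirU L`. -/
theorem ms_mirU_conj_apply (M : Matrix (Orb (FermionTorus 2 L)) (Orb (FermionTorus 2 L)) ℂ)
    (x y : FermionTorus 2 L) (σ σ' : Fin 2) :
    (mirU L * M * mirU L) (orb x σ) (orb y σ') =
      (if 1 ≤ (x.toTorusSite 1).val ∧ (x.toTorusSite 1).val ≤ L / 2 then (-1 : ℂ) else 1) *
        M (orb x σ) (orb y σ') *
          (if 1 ≤ (y.toTorusSite 1).val ∧ (y.toTorusSite 1).val ≤ L / 2 then (-1 : ℂ) else 1) := by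
  simp only [mirU, Matrix.mul_diagonal, Matrix.diagonal_mul, rowOf, orb, ofLex_toLex]
  rfl

/-- Entries of `P_A M P_A`. -/
theorem ms_projA_conj_apply (R : ℕ) (M : Matrix (Orb (FermionTorus 2 L)) (Orb (FermionTorus 2 L)) ℂ)
    (o o' : Orb (FermionTorus 2 L)) :
    (projA L R * M * projA L R) o o' = if o ∈ strA L R ∧ o' ∈ strA L R then M o o' else 0 := by
  simp only [projA, Matrix.mul_diagonal, Matrix.diagonal_mul]
  by_cases h : o ∈ strA L R <;> by_cases h' : o' ∈ strA L R <;> simp [h, h']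

/-- Entries of `P_B M P_B`. -/
theorem ms_projB_conj_apply (R : ℕ) (M : Matrix (Orb (FermionTorus 2 L)) (Orb (FermionTorus 2 L)) ℂ)
    (o o' : Orb (FermionTorus 2 L)) :
    (projB L R * M * projB L R) o o' = if o ∈ mirB L R ∧ o' ∈ mirB L R then M o o' else 0 := by
  simp only [projB, Matrix.mul_diagonal, Matrix.diagonal_mul]
  by_cases h : o ∈ mirB L R <;> by_cases h' : o' ∈ mirB L R <;> simp [h, h']

end Torus

section Vison

variable {L : ℕ} [NeZero L]

/-- Entries of the coboundary perturbation: `V((x,σ),(y,σ')) = 0` if the half-torus signs of `x, y` agree and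
`= −2 N₀((x,σ),(y,σ'))` otherwise. -/
theorem ms_mirV_orb_orb (μ Δ₀ : ℝ) (x y : FermionTorus 2 L) (σ σ' : Fin 2) :
    mirV L μ Δ₀ (orb x σ) (orb y σ') =
      if ((1 ≤ (x.toTorusSite 1).val ∧ (x.toTorusSite 1).val ≤ L / 2) ↔
          (1 ≤ (y.toTorusSite 1).val ∧ (y.toTorusSite 1).val ≤ L / 2)) then 0
      else -2 * visonNambu L μ Δ₀ 0 (orb x σ) (orb y σ') := by
  rw [mirV, Matrix.sub_apply, ms_mirU_conj_apply]
  split_ifs <;> first | (exfalso; tauto) | ring1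

/-! ### Where `V` and `N_R − N₀` live -/

/-- If `N₀((x,σ),(y,σ')) ≠ 0` and the half-torus signs of `x`, `y` differ, then `(x, y)` is a vertical bond of the
bond-row `0|1` or `⌊L/2⌋|⌊L/2⌋+1` (in one of the two orientations). -/
theorem ms_sign_change_of_ne_zero (hL : 4 ≤ L) {μ Δ₀ : ℝ} {x y : FermionTorus 2 L} {σ σ' : Fin 2}
    (hN : visonNambu L μ Δ₀ 0 (orb x σ) (orb y σ') ≠ 0)
    (hne : ¬((1 ≤ (x.toTorusSite 1).val ∧ (x.toTorusSite 1).val ≤ L / 2) ↔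
      (1 ≤ (y.toTorusSite 1).val ∧ (y.toTorusSite 1).val ≤ L / 2))) :
    (y.toTorusSite = x.toTorusSite + Pi.single 1 1 ∧
        (x.toTorusSite 1 = 0 ∨ x.toTorusSite 1 = ((L / 2 : ℕ) : ZMod L))) ∨
      (x.toTorusSite = y.toTorusSite + Pi.single 1 1 ∧
        (y.toTorusSite 1 = 0 ∨ y.toTorusSite 1 = ((L / 2 : ℕ) : ZMod L))) := by
  by_contra hcon
  refine hN (visonNambu_apply_eq_zero μ Δ₀ 0 ?_ (fun i hi => ?_) (fun i hi => ?_) σ σ')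
  · rintro rfl
    exact hne Iff.rfl
  · obtain ⟨rfl, h⟩ := ms_step_sign_change hL hi hne
    exact hcon (Or.inl ⟨hi, h⟩)
  · obtain ⟨rfl, h⟩ := ms_step_sign_change hL hi (fun h => hne h.symm)
    exact hcon (Or.inr ⟨hi, h⟩)

omit [NeZero L] in
/-- A vertical bond of the bond-row `0|1` or `⌊L/2⌋|⌊L/2⌋+1` lies inside `A × A` or inside `B × B`. -/
theorem ms_bond_mem (R : ℕ) {x y : FermionTorus 2 L}
    (hxy : y.toTorusSite = x.toTorusSite + Pi.single 1 1)
    (hx : x.toTorusSite 1 = 0 ∨ x.toTorusSite 1 = ((L / 2 : ℕ) : ZMod L)) (σ σ' : Fin 2) :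
    (orb x σ ∈ strA L R ∧ orb y σ' ∈ strA L R) ∨ (orb x σ ∈ mirB L R ∧ orb y σ' ∈ mirB L R) := by
  have h0 := congrFun hxy 0
  have h1 := congrFun hxy 1
  rw [Pi.add_apply, Pi.single_eq_of_ne (by decide : (0 : Fin 2) ≠ 1), add_zero] at h0
  rw [Pi.add_apply, Pi.single_eq_same] at h1
  rw [ms_orb_mem_strA, ms_orb_mem_strA, ms_orb_mem_mirB, ms_orb_mem_mirB, h0, h1]
  rcases hx with hx | hx <;> rw [hx]
  · rcases Nat.lt_or_ge (x.toTorusSite 0).val R with hc | hc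
    · exact Or.inl ⟨⟨hc, Or.inl rfl⟩, hc, Or.inr (zero_add 1)⟩
    · exact Or.inr ⟨Or.inl ⟨hc, Or.inl rfl⟩, Or.inl ⟨hc, Or.inr (zero_add 1)⟩⟩
  · exact Or.inr ⟨Or.inr (Or.inl rfl), Or.inr (Or.inr (Nat.cast_succ _).symm)⟩

/-- **String bonds flip**: on an upward string bond `(a,0) → (a,1)`, `a < R`, the Nambu entries of `N_R` are
minus those of `N₀` (local gauge `−1` at the lower end). -/
theorem ms_visonNambu_flip (hL : 4 ≤ L) (μ Δ₀ : ℝ) {R : ℕ} {x y : FermionTorus 2 L}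
    (hxy : y.toTorusSite = x.toTorusSite + Pi.single 1 1) (hx1 : x.toTorusSite 1 = 0)
    (hx0 : (x.toTorusSite 0).val < R) (σ σ' : Fin 2) :
    visonNambu L μ Δ₀ R (orb x σ) (orb y σ') = -visonNambu L μ Δ₀ 0 (orb x σ) (orb y σ') := by
  classical
  have hyx : y ≠ x := fun h =>
    ms_add_single_ne hL x.toTorusSite 1 (by rw [h] at hxy; exact hxy.symm)
  set ε : FermionTorus 2 L → ℝ := fun w => if w = x then -1 else 1 with hε
  have hεx : ε x = -1 := by simp [hε]
  have hεy : ε y = 1 := by simp [hε, hyx]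
  have huv : ∀ i : Fin 2, y.toTorusSite = x.toTorusSite + Pi.single i 1 →
      ε x * ε y = sgn L R x.toTorusSite i := by
    intro i hi
    obtain rfl : i = 1 := ms_single_step_unique hL (hi.symm.trans hxy)
    rw [hεx, hεy, sgn, if_pos ⟨rfl, hx1, hx0⟩]
    norm_num
  have hvu : ∀ i : Fin 2, x.toTorusSite = y.toTorusSite + Pi.single i 1 →
      ε y * ε x = sgn L R y.toTorusSite i := fun i hi =>
    absurd (by rw [← hxy]; exact hi.symm) (ms_add_single_add_single_ne hL x.toTorusSite 1 i)
  have hvu' : ∀ i : Fin 2, x.toTorusSite = y.toTorusSite + Pi.single i 1 →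
      ε x * ε y = sgn L R y.toTorusSite i := fun i hi => by rw [mul_comm]; exact hvu i hi
  unfold visonNambu
  rw [bdgNambuMatrix_gauge_orb_orb (visonHop L 0) (visonPair L Δ₀ 0) (visonHop L R)
    (visonPair L Δ₀ R) μ ε x y (fun h => absurd h.symm hyx)
    (visonHop_gauge R huv hvu') (by rw [visonHop_swap R, visonHop_swap 0, visonHop_gauge R huv hvu'])
    (visonPair_gauge Δ₀ R huv) (by rw [mul_comm (ε x : ℂ)]; exact visonPair_gauge Δ₀ R hvu)]
  rw [hεx, hεy]
  push_cast
  ring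

/-- The same for the downward orientation of a string bond (Hermiticity). -/
theorem ms_visonNambu_flip' (hL : 4 ≤ L) (μ Δ₀ : ℝ) {R : ℕ} {x y : FermionTorus 2 L}
    (hyx : x.toTorusSite = y.toTorusSite + Pi.single 1 1) (hy1 : y.toTorusSite 1 = 0)
    (hy0 : (y.toTorusSite 0).val < R) (σ σ' : Fin 2) :
    visonNambu L μ Δ₀ R (orb x σ) (orb y σ') = -visonNambu L μ Δ₀ 0 (orb x σ) (orb y σ') := by
  rw [← (isHermitian_visonNambu (L := L) μ Δ₀ R).apply (orb x σ) (orb y σ'),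
    ← (isHermitian_visonNambu (L := L) μ Δ₀ 0).apply (orb x σ) (orb y σ'),
    ms_visonNambu_flip hL μ Δ₀ hyx hy1 hy0 σ' σ, star_neg]

/-- **Off the string bonds nothing changes**: if `(x, y)` is not a string bond in either orientation, the Nambu
entries of `N_R` and `N₀` agree (trivial gauge). -/
theorem ms_visonNambu_eq (μ Δ₀ : ℝ) {R : ℕ} {x y : FermionTorus 2 L}
    (hxy : ¬(y.toTorusSite = x.toTorusSite + Pi.single 1 1 ∧ x.toTorusSite 1 = 0 ∧
      (x.toTorusSite 0).val < R))
    (hyx : ¬(x.toTorusSite = y.toTorusSite + Pi.single 1 1 ∧ y.toTorusSite 1 = 0 ∧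
      (y.toTorusSite 0).val < R)) (σ σ' : Fin 2) :
    visonNambu L μ Δ₀ R (orb x σ) (orb y σ') = visonNambu L μ Δ₀ 0 (orb x σ) (orb y σ') := by
  have hsgn : ∀ {u v : FermionTorus 2 L},
      ¬(v.toTorusSite = u.toTorusSite + Pi.single 1 1 ∧ u.toTorusSite 1 = 0 ∧
        (u.toTorusSite 0).val < R) →
      ∀ i : Fin 2, v.toTorusSite = u.toTorusSite + Pi.single i 1 →
        (1 : ℝ) * 1 = sgn L R u.toTorusSite i := by
    intro u v h i hi
    have hn : ¬(i = 1 ∧ u.toTorusSite 1 = 0 ∧ (u.toTorusSite 0).val < R) := by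
      rintro ⟨rfl, h0, hR⟩
      exact h ⟨hi, h0, hR⟩
    rw [sgn, if_neg hn, one_mul]
  unfold visonNambu
  rw [bdgNambuMatrix_gauge_orb_orb (visonHop L 0) (visonPair L Δ₀ 0) (visonHop L R)
    (visonPair L Δ₀ R) μ (fun _ => (1 : ℝ)) x y (fun _ => one_mul 1)
    (visonHop_gauge R (ε := fun _ => (1 : ℝ)) (hsgn hxy) (hsgn hyx))
    (by rw [visonHop_swap R, visonHop_swap 0,
      visonHop_gauge R (ε := fun _ => (1 : ℝ)) (hsgn hxy) (hsgn hyx)])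
    (visonPair_gauge Δ₀ R (ε := fun _ => (1 : ℝ)) (hsgn hxy))
    (visonPair_gauge Δ₀ R (ε := fun _ => (1 : ℝ)) (hsgn hyx))]
  push_cast
  ring

end Vison

/-! ### The stub -/

/-- **Mirror set-up** (registered stub `stub_mirrorSetup` of line `Sketch`): for `L ≥ 4`, `2R ≤ L`, the string
orbitals `A` and the mirror complement `B` are disjoint, `V = P_A V P_A + P_B V P_B`, and `N_R = N₀ + P_A V P_A`. -/
theorem stub_mirrorSetup : MirrorSetup := by
  intro L _ hL μ Δ₀ R _
  have hdisj := strA_disjoint_mirB L hL R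
  have hAB : ∀ o, o ∈ strA L R → o ∉ mirB L R := fun o ho ho' =>
    Finset.disjoint_left.mp hdisj ho ho'
  refine ⟨hdisj, ?_, ?_⟩
  · ext o o'
    obtain ⟨⟨x, σ⟩, rfl⟩ : ∃ p : FermionTorus 2 L × Fin 2, toLex p = o := ⟨ofLex o, rfl⟩
    obtain ⟨⟨y, σ'⟩, rfl⟩ : ∃ p : FermionTorus 2 L × Fin 2, toLex p = o' := ⟨ofLex o', rfl⟩
    change mirV L μ Δ₀ (orb x σ) (orb y σ') =
      (projA L R * mirV L μ Δ₀ * projA L R + projB L R * mirV L μ Δ₀ * projB L R) (orb x σ) (orb y σ')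
    rw [Matrix.add_apply, ms_projA_conj_apply, ms_projB_conj_apply]
    by_cases hV : mirV L μ Δ₀ (orb x σ) (orb y σ') = 0
    · rw [hV]; simp
    · have hV' := hV
      rw [ms_mirV_orb_orb] at hV'
      have hne : ¬((1 ≤ (x.toTorusSite 1).val ∧ (x.toTorusSite 1).val ≤ L / 2) ↔
          (1 ≤ (y.toTorusSite 1).val ∧ (y.toTorusSite 1).val ≤ L / 2)) := fun h => hV' (if_pos h)
      have hN : visonNambu L μ Δ₀ 0 (orb x σ) (orb y σ') ≠ 0 := fun h =>
        hV' (by rw [h, mul_zero, ite_self])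
      have key : (orb x σ ∈ strA L R ∧ orb y σ' ∈ strA L R) ∨
          (orb x σ ∈ mirB L R ∧ orb y σ' ∈ mirB L R) := by
        rcases ms_sign_change_of_ne_zero hL hN hne with ⟨hstep, hx⟩ | ⟨hstep, hy⟩
        · exact ms_bond_mem R hstep hx σ σ'
        · rcases ms_bond_mem R hstep hy σ' σ with ⟨h1, h2⟩ | ⟨h1, h2⟩
          · exact Or.inl ⟨h2, h1⟩
          · exact Or.inr ⟨h2, h1⟩
      rcases key with ⟨ha, ha'⟩ | ⟨hb, hb'⟩
      · rw [if_pos ⟨ha, ha'⟩, if_neg (fun h => hAB _ ha h.1), add_zero]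
      · rw [if_neg (fun h => hAB _ h.1 hb), if_pos ⟨hb, hb'⟩, zero_add]
  · ext o o'
    obtain ⟨⟨x, σ⟩, rfl⟩ : ∃ p : FermionTorus 2 L × Fin 2, toLex p = o := ⟨ofLex o, rfl⟩
    obtain ⟨⟨y, σ'⟩, rfl⟩ : ∃ p : FermionTorus 2 L × Fin 2, toLex p = o' := ⟨ofLex o', rfl⟩
    change visonNambu L μ Δ₀ R (orb x σ) (orb y σ') =
      (visonNambu L μ Δ₀ 0 + projA L R * mirV L μ Δ₀ * projA L R) (orb x σ) (orb y σ')
    rw [Matrix.add_apply, ms_projA_conj_apply, ms_mirV_orb_orb]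
    by_cases hxy : y.toTorusSite = x.toTorusSite + Pi.single 1 1 ∧ x.toTorusSite 1 = 0 ∧
        (x.toTorusSite 0).val < R
    · obtain ⟨hstep, hx1, hx0⟩ := hxy
      obtain ⟨h0, h1, hv0, hv1⟩ := ms_string_bond hL hstep hx1
      rw [ms_visonNambu_flip hL μ Δ₀ hstep hx1 hx0,
        if_pos ⟨ms_orb_mem_strA.mpr ⟨hx0, Or.inl hx1⟩,
          ms_orb_mem_strA.mpr (by rw [h0]; exact ⟨hx0, Or.inr h1⟩)⟩,
        if_neg (by rw [hv0, hv1]; intro h; have := (h.mpr ⟨le_rfl, by omega⟩).1; omega)]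
      ring
    by_cases hyx : x.toTorusSite = y.toTorusSite + Pi.single 1 1 ∧ y.toTorusSite 1 = 0 ∧
        (y.toTorusSite 0).val < R
    · obtain ⟨hstep, hy1, hy0⟩ := hyx
      obtain ⟨h0, h1, hv0, hv1⟩ := ms_string_bond hL hstep hy1
      rw [ms_visonNambu_flip' hL μ Δ₀ hstep hy1 hy0,
        if_pos ⟨ms_orb_mem_strA.mpr (by rw [h0]; exact ⟨hy0, Or.inr h1⟩),
          ms_orb_mem_strA.mpr ⟨hy0, Or.inl hy1⟩⟩,
        if_neg (by rw [hv0, hv1]; intro h; have := (h.mp ⟨le_rfl, by omega⟩).1; omega)]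
      ring
    rw [ms_visonNambu_eq μ Δ₀ hxy hyx]
    split_ifs with hA hP
    · ring
    · by_cases hN : visonNambu L μ Δ₀ 0 (orb x σ) (orb y σ') = 0
      · rw [hN]; ring
      · exfalso
        obtain ⟨hxc, hxr⟩ := ms_orb_mem_strA.mp hA.1
        obtain ⟨hyc, hyr⟩ := ms_orb_mem_strA.mp hA.2
        rcases ms_sign_change_of_ne_zero hL hN hP with ⟨hstep, hx | hx⟩ | ⟨hstep, hy | hy⟩
        · exact hxy ⟨hstep, hx, hxc⟩
        · rcases hxr with h | h
          · exact (ms_half_ne hL).1 (hx.symm.trans h)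
          · exact (ms_half_ne hL).2 (hx.symm.trans h)
        · exact hyx ⟨hstep, hy, hyc⟩
        · rcases hyr with h | h
          · exact (ms_half_ne hL).1 (hy.symm.trans h)
          · exact (ms_half_ne hL).2 (hy.symm.trans h)
    · ring

end Summit.HubbardSuperconductivity.HubbardSuperconductivity.Theorems.VisonPairCost

end
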